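import Literature.Analysis.Calculus.QuadraticSolutionMapSmooth
import Literature.Analysis.ODE.WeaklySingularGronwallZero
import Literature.Analysis.UnboundedOperators.SemilinearMildFlowOperators
import HarnessLib

/-!
# The smooth local mild flow of an abstract semilinear parabolic equation

Analysis/UnboundedOperators support file (everything proved; no definitions, no named facts).  Let `E` be a
real Banach space, `T(t)` (`t ≥ 0`) a strongly continuous family of contractions, `K(t)` (`t > 0`) a family
of bounded operators with the weakly singular bound `‖K(t)‖ ≤ C t^{−α}`, `α < 1` (the abstract
`A^α e^{−tA}` of D. Henry, *Geometric Theory of Semilinear Parabolic Equations*, LNM 840 (1981), Thm. 1.4.3),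
`N` a bounded bilinear map on `E` and `f ∈ E` a constant forcing.  A **mild solution** on `[0, τ]` from
`y₀` is a continuous curve with

  `y(t) = T(t) y₀ + ∫₀ᵗ T(t − s) f ds − ∫₀ᵗ K(t − s) N(y(s), y(s)) ds`     (Henry 1981, (3.2.2), §3.3).

`exists_smoothMildFlow_of_duhamel`: given the Duhamel operator `Φ` of `K` on `C([0, τ]; E)`
(`(Φ G)(t) = ∫₀ᵗ K(t − s) G(s) ds`, the sibling `WeaklySingularDuhamel.lean`) on a time interval so short
that `‖Φ‖ ‖N‖ (ρ + 1)² ≤ 1/2` and `τ ‖f‖ ≤ 1/2`, there is a solution map `Ψ : E → C([0, τ]; E)` which is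
**`C^∞` on the ball `‖y₀‖ < ρ`**, such that `Ψ y₀` is a mild solution from `y₀`, it is the **only**
continuous mild solution from `y₀` on `[0, τ]` (no smallness assumed of the competitor), and the derivative
`w = DΨ(y₀) h` is the mild solution of the linearised equation
`w(t) = T(t) h − ∫₀ᵗ K(t − s) (N(y(s), w(s)) + N(w(s), y(s))) ds` — Henry 1981, Thm. 3.3.3 (local existence
and uniqueness), Thm. 3.4.4 and Cor. 3.4.6 (smooth dependence on the initial value, derivative = solution
of the linearisation); A. Pazy, *Semigroups of Linear Operators and Applications to PDE* (1983), Thm. 6.3.1.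

Proof.  With the orbit map `A`, the forcing curve `F₀` and the Nemytskii bilinear map `B` of
`SemilinearMildFlowOperators.lean` the mild equation is the quadratic fixed-point problem
`y = A y₀ + F₀ − Q y y`, `Q y z = Φ (B y z)`, `‖Q y z‖ ≤ ‖Φ‖‖N‖‖y‖‖z‖`, on the Banach space `C([0, τ]; E)`;
the smallness makes the closed ball of radius `ρ + 1` invariant and `Q` a uniform contraction there, so the
tree's `Literature.Analysis.Calculus.exists_contDiffOn_quadraticSolutionMap` (uniform contraction principle)
gives `Ψ`, its smoothness and the derivative identity.  Unconditional uniqueness: the difference `d = ‖z − y‖`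
of two mild solutions obeys `d(t) ≤ C‖N‖(‖y‖ + ‖z‖) ∫₀ᵗ (t − s)^{−α} d(s) ds`
(`norm_integral_weaklySingular_le`), whence `d ≡ 0` by the homogeneous singular Grönwall lemma
`Literature.Analysis.ODE.eq_zero_of_le_mul_integral_rpow_neg_mul` (Henry 1981, Lemma 7.1.1).

## References

* D. Henry, *Geometric Theory of Semilinear Parabolic Equations*, LNM 840, Springer (1981), §3.2 (3.2.2),
  Lemma 3.3.2, Thm. 3.3.3, Thm. 3.4.4, Cor. 3.4.6, Lemma 7.1.1. [Henry1981]
* A. Pazy, *Semigroups of Linear Operators and Applications to Partial Differential Equations*, Springer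
  (1983), §6.3, Thm. 6.3.1. [Pazy1983]
-/

noncomputable section

open Set Filter MeasureTheory intervalIntegral Metric
open _root_.Topology
open scoped ContDiff

namespace Literature.Analysis.UnboundedOperators

variable {E : Type*} [NormedAddCommGroup E] [NormedSpace ℝ E] [CompleteSpace E]

/-- **The smooth local mild flow, given the Duhamel operator** (Henry 1981, Thm. 3.3.3, Thm. 3.4.4,
Cor. 3.4.6; Pazy 1983, Thm. 6.3.1).  Let `T(t)` be strongly continuous contractions (`t ≥ 0`), `K(t)` bounded
operators with `‖K(t)‖ ≤ C t^{−α}` (`C ≥ 0`, `α < 1`), `N` bounded bilinear, `f ∈ E`, `ρ > 0`, and let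
`Φ` be the Duhamel operator of `K` on `C([0, τ]; E)`, `(Φ G)(t) = ∫₀ᵗ K(t − s) G(s) ds`, on a time interval
with `‖Φ‖ ‖N‖ (ρ + 1)² ≤ 1/2` and `τ ‖f‖ ≤ 1/2`.  Then there is `Ψ : E → C([0, τ]; E)`, `C^∞` on the ball
`‖y₀‖ < ρ`, such that for `‖y₀‖ < ρ`: `Ψ y₀` solves
`y(t) = T(t)y₀ + ∫₀ᵗ T(t − s) f ds − ∫₀ᵗ K(t − s) N(y(s), y(s)) ds`; every continuous solution of this
equation on `[0, τ]` equals `Ψ y₀`; and `w = DΨ(y₀) h` solves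
`w(t) = T(t) h − ∫₀ᵗ K(t − s) (N(y(s), w(s)) + N(w(s), y(s))) ds`. [cite: Henry1981, Thm 3.4.4] -/
theorem exists_smoothMildFlow_of_duhamel (T K : ℝ → E →L[ℝ] E) (hTnorm : ∀ t, 0 ≤ t → ‖T t‖ ≤ 1)
    (hTc : ∀ y : E, Continuous fun t : ℝ => T t y) {α C : ℝ} (hα : α < 1) (hC : 0 ≤ C)
    (hK : ∀ t, 0 < t → ‖K t‖ ≤ C * t ^ (-α)) (N : E →L[ℝ] E →L[ℝ] E) (f : E) {ρ τ : ℝ} (hρ : 0 < ρ)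
    (hτ : 0 < τ) (Φ : C(Icc (0 : ℝ) τ, E) →L[ℝ] C(Icc (0 : ℝ) τ, E))
    (hΦ : ∀ (G : C(Icc (0 : ℝ) τ, E)) (t : Icc (0 : ℝ) τ),
      Φ G t = ∫ s in (0 : ℝ)..(t : ℝ), K ((t : ℝ) - s) (G (Set.projIcc 0 τ hτ.le s)))
    (hΦN : ‖Φ‖ * ‖N‖ * (ρ + 1) ^ 2 ≤ 1 / 2) (hτf : τ * ‖f‖ ≤ 1 / 2) :
    ∃ Ψ : E → C(Icc (0 : ℝ) τ, E),
      ContDiffOn ℝ ∞ Ψ (ball 0 ρ) ∧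
      (∀ y₀ ∈ ball (0 : E) ρ, ∀ t : Icc (0 : ℝ) τ,
        Ψ y₀ t = T t y₀ + (∫ s in (0 : ℝ)..(t : ℝ), T ((t : ℝ) - s) f) -
          ∫ s in (0 : ℝ)..(t : ℝ), K ((t : ℝ) - s)
            (N (Ψ y₀ (Set.projIcc 0 τ hτ.le s)) (Ψ y₀ (Set.projIcc 0 τ hτ.le s)))) ∧
      (∀ y₀ ∈ ball (0 : E) ρ, ∀ z : C(Icc (0 : ℝ) τ, E),
        (∀ t : Icc (0 : ℝ) τ, z t = T t y₀ + (∫ s in (0 : ℝ)..(t : ℝ), T ((t : ℝ) - s) f) -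
          ∫ s in (0 : ℝ)..(t : ℝ), K ((t : ℝ) - s)
            (N (z (Set.projIcc 0 τ hτ.le s)) (z (Set.projIcc 0 τ hτ.le s)))) → z = Ψ y₀) ∧
      (∀ y₀ ∈ ball (0 : E) ρ, ∀ (h : E) (t : Icc (0 : ℝ) τ),
        fderiv ℝ Ψ y₀ h t = T t h - ∫ s in (0 : ℝ)..(t : ℝ), K ((t : ℝ) - s)
          (N (Ψ y₀ (Set.projIcc 0 τ hτ.le s)) (fderiv ℝ Ψ y₀ h (Set.projIcc 0 τ hτ.le s)) +
            N (fderiv ℝ Ψ y₀ h (Set.projIcc 0 τ hτ.le s)) (Ψ y₀ (Set.projIcc 0 τ hτ.le s)))) := by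
  -- ### the operators of the mild formulation
  obtain ⟨A, hA, hAn⟩ := exists_orbitCLM T hTnorm hTc τ
  obtain ⟨F₀, hF₀, hF₀n⟩ := exists_forcingCurve T hTnorm hTc f τ
  obtain ⟨B, hB, hBn⟩ := exists_nemytskiiBilinearCLM (K := Icc (0 : ℝ) τ) N
  set Q : C(Icc (0 : ℝ) τ, E) →L[ℝ] C(Icc (0 : ℝ) τ, E) →L[ℝ] C(Icc (0 : ℝ) τ, E) :=
    (ContinuousLinearMap.compL ℝ C(Icc (0 : ℝ) τ, E) C(Icc (0 : ℝ) τ, E) C(Icc (0 : ℝ) τ, E) Φ).comp B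
    with hQdef
  have hQ : ∀ y z, Q y z = Φ (B y z) := fun y z => rfl
  set R : ℝ := ρ + 1 with hR
  set L : ℝ := ‖Φ‖ * ‖N‖ with hL
  have hL0 : 0 ≤ L := by positivity
  have hQle : ∀ y z, ‖Q y z‖ ≤ L * ‖y‖ * ‖z‖ := fun y z => by
    rw [hQ]
    calc ‖Φ (B y z)‖ ≤ ‖Φ‖ * ‖B y z‖ := Φ.le_opNorm _
      _ ≤ ‖Φ‖ * (‖N‖ * ‖y‖ * ‖z‖) := by gcongr; exact hBn y z
      _ = L * ‖y‖ * ‖z‖ := by rw [hL]; ring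
  have hF₀norm : ‖F₀‖ ≤ 1 / 2 := (ContinuousMap.norm_le _ (by norm_num)).2 fun t =>
    (hF₀n t).trans ((mul_le_mul_of_nonneg_right t.2.2 (norm_nonneg f)).trans hτf)
  have hself : ∀ g ∈ ball (0 : E) ρ, ‖A g + F₀‖ + L * R ^ 2 ≤ R := fun g hg => by
    have h1 : ‖A g‖ ≤ ρ := (hAn g).trans (mem_ball_zero_iff.1 hg).le
    linarith [norm_add_le (A g) F₀, hΦN]
  have hcontr : 2 * L * R < 1 := by
    have hR1 : 1 < R := by rw [hR]; linarith
    by_contra hcon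
    have h1 : R ≤ 2 * L * R * R := by nlinarith
    nlinarith [hΦN]
  -- ### the solution map (uniform contraction principle)
  obtain ⟨Ψ, hΨs, hΨfix, -, -, hΨd⟩ :=
    Literature.Analysis.Calculus.exists_contDiffOn_quadraticSolutionMap A F₀ Q (by positivity) hL0 hQle
      hself hcontr
  -- the mild equation
  have hmild : ∀ y₀ ∈ ball (0 : E) ρ, ∀ t : Icc (0 : ℝ) τ,
      Ψ y₀ t = T t y₀ + (∫ s in (0 : ℝ)..(t : ℝ), T ((t : ℝ) - s) f) -
        ∫ s in (0 : ℝ)..(t : ℝ), K ((t : ℝ) - s)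
          (N (Ψ y₀ (Set.projIcc 0 τ hτ.le s)) (Ψ y₀ (Set.projIcc 0 τ hτ.le s))) := by
    intro y₀ hy₀ t
    have h := congrArg (fun z : C(Icc (0 : ℝ) τ, E) => z t) (hΨfix y₀ hy₀)
    rw [h, ContinuousMap.sub_apply, ContinuousMap.add_apply, hA, hF₀, hQ, hΦ]
    simp only [hB]
  refine ⟨Ψ, hΨs, hmild, fun y₀ hy₀ z hz => ?_, fun y₀ hy₀ h t => ?_⟩
  · -- ### unconditional uniqueness (singular Grönwall)
    set y : C(Icc (0 : ℝ) τ, E) := Ψ y₀ with hy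
    set d : ℝ → ℝ := fun s => ‖z (Set.projIcc 0 τ hτ.le s) - y (Set.projIcc 0 τ hτ.le s)‖ with hd
    have hdc : Continuous d :=
      ((z.continuous.comp continuous_projIcc).sub (y.continuous.comp continuous_projIcc)).norm
    have hdiff : ∀ t : Icc (0 : ℝ) τ, z t - y t = Φ (B y y - B z z) t := by
      intro t
      rw [map_sub, ContinuousMap.sub_apply, hΦ, hΦ]
      simp only [hB]
      rw [hz t, hmild y₀ hy₀ t]
      abel
    have hle : ∀ t ∈ Icc (0 : ℝ) τ,
        d t ≤ (C * (‖N‖ * (‖y‖ + ‖z‖))) * ∫ s in (0 : ℝ)..t, (t - s) ^ (-α) * d s := by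
      intro t ht
      have hg : Continuous fun s => (B y y - B z z) (Set.projIcc 0 τ hτ.le s) :=
        (B y y - B z z).continuous.comp continuous_projIcc
      have hpt : ∀ s, ‖(B y y - B z z) (Set.projIcc 0 τ hτ.le s)‖ ≤ ‖N‖ * (‖y‖ + ‖z‖) * d s := by
        intro s
        rw [ContinuousMap.sub_apply, hB, hB, hd]
        beta_reduce
        rw [norm_sub_rev (z _)]
        calc ‖N (y (Set.projIcc 0 τ hτ.le s)) (y (Set.projIcc 0 τ hτ.le s)) -
              N (z (Set.projIcc 0 τ hτ.le s)) (z (Set.projIcc 0 τ hτ.le s))‖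
            ≤ ‖N‖ * (‖y (Set.projIcc 0 τ hτ.le s)‖ + ‖z (Set.projIcc 0 τ hτ.le s)‖) *
                ‖y (Set.projIcc 0 τ hτ.le s) - z (Set.projIcc 0 τ hτ.le s)‖ :=
              Literature.Analysis.Calculus.norm_bilinear_diag_sub_le N _ _
          _ ≤ ‖N‖ * (‖y‖ + ‖z‖) * ‖y (Set.projIcc 0 τ hτ.le s) - z (Set.projIcc 0 τ hτ.le s)‖ := by
              gcongr
              · exact ContinuousMap.norm_coe_le_norm y _
              · exact ContinuousMap.norm_coe_le_norm z _
      calc d t = ‖Φ (B y y - B z z) ⟨t, ht⟩‖ := by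
            simp only [hd]
            rw [Set.projIcc_of_mem hτ.le ht, hdiff]
        _ = ‖∫ s in (0 : ℝ)..t, K (t - s) ((B y y - B z z) (Set.projIcc 0 τ hτ.le s))‖ := by rw [hΦ]
        _ ≤ C * ∫ s in (0 : ℝ)..t, (t - s) ^ (-α) * ‖(B y y - B z z) (Set.projIcc 0 τ hτ.le s)‖ :=
            norm_integral_weaklySingular_le hα hK hg ht.1
        _ ≤ C * ∫ s in (0 : ℝ)..t, (t - s) ^ (-α) * (‖N‖ * (‖y‖ + ‖z‖) * d s) := by
            refine mul_le_mul_of_nonneg_left (intervalIntegral.integral_mono_on ht.1 ?_ ?_ fun s hs => ?_) hC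
            · exact Literature.Analysis.ODE.intervalIntegrable_sub_rpow_neg_mul hα t hg.norm.continuousOn
            · exact Literature.Analysis.ODE.intervalIntegrable_sub_rpow_neg_mul hα t
                ((continuous_const.mul hdc).continuousOn)
            · exact mul_le_mul_of_nonneg_left (hpt s) (Real.rpow_nonneg (sub_nonneg.2 hs.2) _)
        _ = (C * (‖N‖ * (‖y‖ + ‖z‖))) * ∫ s in (0 : ℝ)..t, (t - s) ^ (-α) * d s := by
            rw [mul_assoc C, ← intervalIntegral.integral_const_mul (‖N‖ * (‖y‖ + ‖z‖))]
            congr 1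
            refine intervalIntegral.integral_congr fun s _ => ?_
            ring
    have hzero := Literature.Analysis.ODE.eq_zero_of_le_mul_integral_rpow_neg_mul hα hdc.continuousOn
      (fun s _ => norm_nonneg _) hle
    ext t
    have h0 := hzero t t.2
    simp only [hd] at h0
    rw [Set.projIcc_val hτ.le t] at h0
    exact sub_eq_zero.1 (norm_eq_zero.1 h0)
  · -- ### the derivative solves the linearised equation
    have hdv := congrArg (fun z : C(Icc (0 : ℝ) τ, E) => z t) (hΨd y₀ hy₀ h)
    rw [hdv, ContinuousMap.sub_apply, hA, hQ, hQ, ← map_add, hΦ]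
    simp only [ContinuousMap.add_apply, hB]

end Literature.Analysis.UnboundedOperators

end
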